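import Summits.QuantumFields.BalabanUV.Beta.GAN24.BackgroundVertexChain
import Summits.QuantumFields.BalabanUV.Beta.GAN24.ThreeLegChainKing
import Summits.QuantumFields.BalabanUV.Beta.GAN24.SoftColumnKernelDecay

/-!
# `BalabanUV.Beta.GAN24.BackgroundVertexChainLoc` — binder row G-an2-4 ∕ (CONV-C), route R7, road P2: the BACKGROUND-VERTEX CHAIN of
# `BackgroundVertexChain` (two gradient legs of `H_k`, vertex linear in the soft column `M̃_k(·,b)` sourced at a unit bond `b`) RE-DISPLAYED
# WITH THE SOFT COLUMN'S **DECAYING** KERNEL LETTER: it is a THREE-LEG chain (`ThreeLegChainKing.chain3`, legs `∂H`, `𝒢Q*(·,b)`, `∂H`,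
# constant cubic vertex), hence obeys BOTH (CONV-C) CLAUSES with THREE-CENTRE decay `e^{−κ(|y − b̄|_T + |b̄ − y′|_T)}` — `U = 1`, `a = 1`,
# every CUBIC torus, `L ≥ 2`, `θ = θG(L,½) = L^{−1∕4}` (refuter `PRICING-GAN24` v3.14 rider K-loc = Q19: «the consumer sums `Σ_b u(b)·K_b(y,y′)`»)

NOT IN PRINT; OUR PROOF ATTEMPT (unit `b2b-balaban-gan24-p2`, gen 32 = prover-b2b-balaban-gan24-p2-g32-0, road-P2 chair of row G-an2-4;
CRUX TEAM (2) under the ruling «YM REDIRECT TOWARDS THE SUMMIT», 2026-08-21).  HONEST FRAMING (cell contract, verbatim): «discharging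
`BetaPertH` makes Bałaban's UV stability UNCONDITIONAL — a real constructive-QFT result; it is NOT the continuum limit and NOT the Clay
problem.»  HONEST DEPENDENCY (verbatim): «continuum YM on T⁴ ⇐ BetaPertH ∧ nine spine estimates (0/9 proved); BetaPertH ⇐ (D1) ∧ (D4) ∧
CAP+tail; G-an2-4 gates asym, D1 and NE2/3/4.»  ABSOLUTE RULE: nothing printed is a hypothesis; no `def … : Prop`, no `sorry`; [folklore]
packaging BY NAME of (J) `ThreeLegChainKing` (`norm_chain3_le`, `norm_chain3_succ_sub_le`, three-centre budget `δ∕3`), (H)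
`TwoLegChainInstances.dLeg` + (C) `HkGradientKingRate.norm_dker_par_sub_le_lev` (gradient legs), gan24-p3-g27's
`SoftColumnKernelDecay.colOp_two_clauses_cubic` (the soft column `𝒢Q*` in kernel currency, `a = 1`, cubic: decay from the unit bond AND the
one-step law against the staircase, amplitude `((L−1)∕(L n_k))(2 + log(L n_k) + log n_k) + 1∕n_k`), p3's `HkStaircaseOneStep.stairV_mul_apply`
(staircase = King's parent pull-back).  WHICH of an1's rows T1–T3 (if any) this class realises is NOT claimed.

## Content (0 sorry)
 * §0 real bookkeeping: `thetaG_half_sq` (`θG(L,½)² = θG(L,1)`), `succ_mul_inv_pow_le` (`(k+1)(L⁻¹)^k ≤ (1−θG)⁻¹·θG^k`, the linear factor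
   against `k+1` terms of the geometric series), `colAmp_le` (p3's log amplitude along `n_k = L^k` is `≤ (3 + 2 log L)(1−θG)⁻¹·θG^k`).
 * §1 the COLUMN LEG `cLeg n x μ s := (𝒢_1Q*)_n((x,μ), s)` and its two letters in chain currency (decay from the block of `x` to the unit
   source; parent law at rate `colAmp`), every cubic torus — p3's two clauses read through `stairV_mul_apply` and the period invariance of `|·|_T`.
 * §2 `vtxChain_bgVtx_eq_chain3`: at `a = 1` the background-vertex chain `K_b = vtxChain n T (bgVtx n T 1 c b)` IS `chain3` with legs
   `(∂H, 𝒢Q*(·,b), ∂H)` and the constant cubic vertex `(i, μ, j) ↦ c i j μ`.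
 * §3 **`bg_chain_two_clauses_loc`**: `∃ κ > 0, C ≥ 0, 0 ≤ θ < 1` (θ = θG(L,½)) with, for every level `k`, cubic torus `N₀`, unit bond
   `b = (b̄, λ_b)`, sources `(y,λ), (y′,λ′)`:
   (i) `‖K_b^{(n_k)}(y,λ;y′,λ′)‖ ≤ C·e^{−κ(|y−b̄|_T + |b̄−y′|_T)}`; (ii) `‖K_b^{(n_{k+1})} − K_b^{(n_k)}‖(y,λ;y′,λ′) ≤ C·θ^k·e^{−κ(|y−b̄|_T + |b̄−y′|_T)}`.
   The constants depend on `d, L, c` only (NOT on `N₀`): the letter is summable in `b` uniformly in the volume, which is what a `Σ_b u(b)·K_b`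
   consumer needs (refuter Q19).
HONEST.  [folklore]; `a = 1` and CUBIC tori only (the scope of p3's kernel letters for `𝒢Q*`; (K) `bg_chain_two_clauses` remains the every-`a`,
every-torus, `b`-uniform statement); exponent `L^{−1∕4}` from the gradient legs (interpolation) — the column's `(k+1)L^{−k}` is dominated, not
sharp; U = 1; NOT (CONV-C) as typed, NEVER «G-an2-4 closed», NOT NE2, NOT D1, NOT BetaPertH, NOT continuum, NOT Clay.  Text locations only:
[Balaban1984PropagatorsI] (1.71) p. 29, (1.100)–(1.103) p. 35; [King1986] §4 p. 672, p. 664.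
-/

noncomputable section

open scoped BigOperators Matrix
open Finset

namespace Summit.QuantumFields.BalabanUV.Beta.GAN24.BackgroundVertexChainLoc

open Literature.MathematicalPhysics.QuantumFieldTheory.Balaban1983to89
open Literature.MathematicalPhysics.QuantumFieldTheory.Balaban1983to89.B5Prop11Plancherel (Tor fine)
open Literature.MathematicalPhysics.QuantumFieldTheory.Balaban1983to89.B4TorusKernel.MultiPeriod (torusSupNorm)
open Literature.MathematicalPhysics.QuantumFieldTheory.Balaban1983to89.B4Sect5Proof (latticeConst latticeConst_nonneg)
open Literature.MathematicalPhysics.QuantumFieldTheory.Balaban1983to89.B5Blocks16 (blockOf blockOf_bpt)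
open Literature.MathematicalPhysics.QuantumFieldTheory.Balaban1983to89.B6LowerBound2153Torus (toT rep toT_rep isPeriod_rep_toT_sub)
open Literature.MathematicalPhysics.QuantumFieldTheory.Balaban1983to89.B6Lemma24Torus (IsPeriod)
open Literature.MathematicalPhysics.QuantumFieldTheory.Balaban1983to89.B5G183RateUnitTower (lev lev_neZero)
open Literature.MathematicalPhysics.QuantumFieldTheory.Balaban1983to89.B5Hk163TorusHolder (dker)
open Literature.MathematicalPhysics.QuantumFieldTheory.Balaban1983to89.B5Hk163TorusHolderDecay (CdecD CdecD_nonneg)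
open Literature.MathematicalPhysics.QuantumFieldTheory.Balaban1983to89.T4EtaRateSiteTorus (torusSupNorm_eq_of_isPeriod_sub)
open Summit.QuantumFields.BalabanUV.T4Continuum.BalabanAveragedTowerModes (par)
open Summit.QuantumFields.BalabanUV.T4Continuum.BlockPairingGeometry (parT)
open Summit.QuantumFields.BalabanUV.T4Continuum.BalabanAveragedTowerUnit (cast_lev')
open Summit.QuantumFields.BalabanUV.Beta.GAN24.StaircaseAveragingDefect (stairV)
open Summit.QuantumFields.BalabanUV.Beta.GAN24.SoftVectorMinimiserTwoLevel (MsoftV)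
open Summit.QuantumFields.BalabanUV.Beta.GAN24.SoftColumnTwoLevel (colOp MsoftV_eq_smul_colOp)
open Summit.QuantumFields.BalabanUV.Beta.GAN24.HkKingOneStepSup (eq_bpt_and_par_eq)
open Summit.QuantumFields.BalabanUV.Beta.GAN24.HkStaircaseOneStep (stairV_mul_apply)
open Summit.QuantumFields.BalabanUV.Beta.GAN24.HkKingOneStep (dec dec_pos)
open Summit.QuantumFields.BalabanUV.Beta.GAN24.HkGradientKingRate (thetaG thetaG_pos thetaG_lt_one CG CG_nonneg norm_dker_par_sub_le_lev)
open Summit.QuantumFields.BalabanUV.Beta.GAN24.GradientVertexChainKing (VIdx vtxChain norm_dker_le_block)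
open Summit.QuantumFields.BalabanUV.Beta.GAN24.TwoLegChainKing (Src)
open Summit.QuantumFields.BalabanUV.Beta.GAN24.TwoLegChainInstances (dLeg norm_dLeg_par_le)
open Summit.QuantumFields.BalabanUV.Beta.GAN24.ThreeLegChainKing (chain3 norm_chain3_le norm_chain3_succ_sub_le)
open Summit.QuantumFields.BalabanUV.Beta.GAN24.BackgroundVertexChain (bgVtx cnorm cnorm_nonneg sum_norm_le_cnorm)
open Summit.QuantumFields.BalabanUV.Beta.GAN24.SoftColumnKernelDecay (colOp_two_clauses_cubic)

variable {d : ℕ}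

/-! ## §0 Real bookkeeping: the column's log amplitude is dominated by `θG^k` -/

section Real

/-- `θG(L,½)² = θG(L,1)` (`= (L⁻¹)^{1∕2}`). [folklore] -/
theorem thetaG_half_sq (L : ℕ) : thetaG L (1/2) ^ 2 = thetaG L 1 := by
  unfold thetaG
  rw [← Real.rpow_natCast, ← Real.rpow_mul (inv_nonneg.mpr (Nat.cast_nonneg L))]
  norm_num

/-- `L⁻¹ ≤ θG(L,½)²` (`L ≥ 1`). [folklore] -/
theorem inv_le_thetaG_half_sq {L : ℕ} (hL : 1 ≤ L) : ((L : ℝ)⁻¹) ≤ thetaG L (1/2) ^ 2 := by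
  rw [thetaG_half_sq]
  unfold thetaG
  have hL0 : (0 : ℝ) < L := by exact_mod_cast hL
  have hx0 : 0 < ((L : ℝ)⁻¹) := inv_pos.mpr hL0
  have hx1 : ((L : ℝ)⁻¹) ≤ 1 := inv_le_one_of_one_le₀ (by exact_mod_cast hL)
  conv_lhs => rw [← Real.rpow_one ((L : ℝ)⁻¹)]
  exact Real.rpow_le_rpow_of_exponent_ge hx0 hx1 (by norm_num)

/-- **`(k+1)·(L⁻¹)^k ≤ (1 − θG)⁻¹·θG^k`** (`L ≥ 2`, `θG = θG(L,½) = L^{−1∕4}`): the linear factor is absorbed by half of the room between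
`L⁻¹` and `θG`. [folklore] -/
theorem succ_mul_inv_pow_le {L : ℕ} (hL : 2 ≤ L) (k : ℕ) :
    ((k : ℝ) + 1) * ((L : ℝ)⁻¹) ^ k ≤ (1 - thetaG L (1/2))⁻¹ * thetaG L (1/2) ^ k := by
  have hL1 : 1 ≤ L := le_trans (by norm_num) hL
  have hϑ0 : 0 ≤ thetaG L (1/2) := (thetaG_pos hL1 _).le
  have hϑ1 : thetaG L (1/2) < 1 := thetaG_lt_one hL (by norm_num)
  have hL0 : (0 : ℝ) ≤ ((L : ℝ)⁻¹) := inv_nonneg.mpr (Nat.cast_nonneg L)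
  have h1 : ((L : ℝ)⁻¹) ^ k ≤ (thetaG L (1/2) ^ 2) ^ k := pow_le_pow_left₀ hL0 (inv_le_thetaG_half_sq hL1) k
  -- `(k+1)·ϑ^k ≤ (1−ϑ)⁻¹`: each of the `k+1` copies of `ϑ^k` is below one term `ϑ^i`, `i ≤ k`, of the geometric series
  have h2 : ((k : ℝ) + 1) * thetaG L (1/2) ^ k ≤ (1 - thetaG L (1/2))⁻¹ := by
    have e : ((k : ℝ) + 1) * thetaG L (1/2) ^ k = ∑ _i ∈ Finset.range (k + 1), thetaG L (1/2) ^ k := by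
      rw [Finset.sum_const, Finset.card_range, nsmul_eq_mul]; push_cast; ring
    rw [e]
    calc ∑ _i ∈ Finset.range (k + 1), thetaG L (1/2) ^ k ≤ ∑ i ∈ Finset.range (k + 1), thetaG L (1/2) ^ i :=
          Finset.sum_le_sum fun i hi => pow_le_pow_of_le_one hϑ0 hϑ1.le (Nat.lt_succ_iff.mp (Finset.mem_range.mp hi))
      _ ≤ (1 - thetaG L (1/2))⁻¹ :=
          sum_le_hasSum (Finset.range (k + 1)) (fun i _ => pow_nonneg hϑ0 i) (hasSum_geometric_of_lt_one hϑ0 hϑ1)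
  calc ((k : ℝ) + 1) * ((L : ℝ)⁻¹) ^ k ≤ ((k : ℝ) + 1) * (thetaG L (1/2) ^ 2) ^ k := mul_le_mul_of_nonneg_left h1 (by positivity)
    _ = (((k : ℝ) + 1) * thetaG L (1/2) ^ k) * thetaG L (1/2) ^ k := by rw [← pow_mul, mul_comm 2 k, pow_mul]; ring
    _ ≤ (1 - thetaG L (1/2))⁻¹ * thetaG L (1/2) ^ k := mul_le_mul_of_nonneg_right h2 (pow_nonneg hϑ0 k)

/-- **THE COLUMN's LOG AMPLITUDE ALONG `n_k = L^k` IS DOMINATED BY `θG^k`** (`L ≥ 2`):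
`((L−1)∕(L n_k))·(2 + log(L n_k) + log n_k) + 1∕n_k ≤ (3 + 2 log L)·(1 − θG)⁻¹·θG(L,½)^k`. [folklore] -/
theorem colAmp_le {L : ℕ} [NeZero L] (hL : 2 ≤ L) (k : ℕ) :
    (((L : ℝ) - 1) / ((L : ℝ) * (lev L k : ℕ))) * (2 + Real.log ((L * lev L k : ℕ) : ℝ) + Real.log ((lev L k : ℕ) : ℝ)) + 1 / (lev L k : ℕ)
      ≤ ((3 + 2 * Real.log L) * (1 - thetaG L (1/2))⁻¹) * thetaG L (1/2) ^ k := by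
  have hL1 : 1 ≤ L := le_trans (by norm_num) hL
  have hL0 : (0 : ℝ) < L := by exact_mod_cast hL1
  have hℓ : 0 ≤ Real.log L := Real.log_nonneg (by exact_mod_cast hL1)
  have hn : ((lev L k : ℕ) : ℝ) = (L : ℝ) ^ k := cast_lev' L k
  have hLn : ((L * lev L k : ℕ) : ℝ) = (L : ℝ) ^ (k + 1) := by push_cast; rw [hn, pow_succ]; ring
  have hpow : (0 : ℝ) < (L : ℝ) ^ k := pow_pos hL0 k
  rw [hn, hLn, Real.log_pow, Real.log_pow]
  -- `(L−1)/(L·L^k) ≤ (L⁻¹)^k` and `1/L^k = (L⁻¹)^k`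
  have hx : ((L : ℝ)⁻¹) ^ k = 1 / (L : ℝ) ^ k := by rw [inv_pow, one_div]
  have hfrac : ((L : ℝ) - 1) / ((L : ℝ) * (L : ℝ) ^ k) ≤ ((L : ℝ)⁻¹) ^ k := by
    rw [hx, div_le_div_iff₀ (by positivity) hpow]
    nlinarith
  have hfrac0 : 0 ≤ ((L : ℝ) - 1) / ((L : ℝ) * (L : ℝ) ^ k) := div_nonneg (by linarith [show (1:ℝ) ≤ L by exact_mod_cast hL1]) (by positivity)
  have hlog : 0 ≤ 2 + ((k + 1 : ℕ) : ℝ) * Real.log L + (k : ℝ) * Real.log L := by positivity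
  have hk : ((k + 1 : ℕ) : ℝ) = (k : ℝ) + 1 := by push_cast; ring
  calc ((L : ℝ) - 1) / ((L : ℝ) * (L : ℝ) ^ k) * (2 + ((k + 1 : ℕ) : ℝ) * Real.log L + (k : ℝ) * Real.log L) + 1 / (L : ℝ) ^ k
      ≤ ((L : ℝ)⁻¹) ^ k * (2 + ((k + 1 : ℕ) : ℝ) * Real.log L + (k : ℝ) * Real.log L) + ((L : ℝ)⁻¹) ^ k := by
        rw [← hx]; exact add_le_add (mul_le_mul_of_nonneg_right hfrac hlog) le_rfl
    _ = ((L : ℝ)⁻¹) ^ k * (3 + (2 * (k : ℝ) + 1) * Real.log L) := by rw [hk]; ring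
    _ ≤ ((L : ℝ)⁻¹) ^ k * (((k : ℝ) + 1) * (3 + 2 * Real.log L)) := by
        refine mul_le_mul_of_nonneg_left ?_ (pow_nonneg (inv_nonneg.mpr hL0.le) k)
        nlinarith [Nat.cast_nonneg (α := ℝ) k]
    _ = (3 + 2 * Real.log L) * (((k : ℝ) + 1) * ((L : ℝ)⁻¹) ^ k) := by ring
    _ ≤ (3 + 2 * Real.log L) * ((1 - thetaG L (1/2))⁻¹ * thetaG L (1/2) ^ k) :=
        mul_le_mul_of_nonneg_left (succ_mul_inv_pow_le hL k) (by positivity)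
    _ = _ := by ring

end Real

/-! ## §1 The column leg and its two letters in chain currency (a = 1, cubic tori) -/

section ColumnLeg

variable (N₀ : ℕ) [NeZero N₀]

/-- **the COLUMN LEG**: `cLeg n x μ s := (𝒢_1Q*)_n((x,μ), s)` — Bałaban's soft column (1.103) sourced at the unit bond `s`, read at the fine
bond `(x, μ)`, in the leg format of `chain3`. [folklore] -/
def cLeg (n : ℕ) [NeZero n] (x : Tor (fine n (fun _ : Fin (d + 1) => N₀))) (μ : Fin (d + 1))
    (s : Src (fun _ : Fin (d + 1) => N₀)) : ℂ :=
  colOp n (fun _ : Fin (d + 1) => N₀) 1 (x, μ) s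

/-- the torus distance does not see the choice of representative of the source: `|r − rep(toT y)|_T = |r − y|_T`. [folklore] -/
theorem torusSupNorm_sub_rep_toT (r y : Fin (d + 1) → ℤ) :
    torusSupNorm (fun _ : Fin (d + 1) => N₀) (r - rep (fun _ : Fin (d + 1) => N₀) (toT (fun _ : Fin (d + 1) => N₀) y))
      = torusSupNorm (fun _ : Fin (d + 1) => N₀) (r - y) := by
  refine torusSupNorm_eq_of_isPeriod_sub (fun i => ?_)
  have h := isPeriod_rep_toT_sub (fun _ : Fin (d + 1) => N₀) y i
  simp only [Pi.sub_apply] at h ⊢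
  have e : r i - rep (fun _ : Fin (d + 1) => N₀) (toT (fun _ : Fin (d + 1) => N₀) y) i - (r i - y i)
      = -(rep (fun _ : Fin (d + 1) => N₀) (toT (fun _ : Fin (d + 1) => N₀) y) i - y i) := by ring
  rw [e]
  exact (dvd_neg).mpr h

/-- the unit block of a fine point is the unit block of its parent. [folklore] -/
theorem blockOf_par_eq {N R : ℕ} [NeZero N] [NeZero R] (M : Fin (d + 1) → ℕ) [∀ μ, NeZero (M μ)] (x' : Tor (fine (R * N) M)) :
    blockOf N M (par N R M x') = blockOf (R * N) M x' := by
  obtain ⟨_, hp⟩ := eq_bpt_and_par_eq (N := N) (R := R) M x'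
  rw [hp, blockOf_bpt, toT_rep]

/-- **THE COLUMN LEG's TWO LETTERS** (from p3-g27's `colOp_two_clauses_cubic` BY NAME; `a = 1`, every cubic torus, constants `d`-only):
`∃ K δ > 0` with (i) `‖cLeg n x μ (toT y, λ)‖ ≤ K·e^{−δ|ȳ(x) − y|_T}` at every level, and (ii) along King's parent
`‖cLeg (R N) x′ μ (toT y, λ) − cLeg N (par x′) μ (toT y, λ)‖ ≤ K·(((R−1)∕(R N))(2 + log(R N) + log N) + 1∕N)·e^{−δ|ȳ(x′) − y|_T}`.
[cite: Balaban1984PropagatorsI, (1.103) p.35; King1986, p.664] [folklore] -/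
theorem cLeg_letters (d : ℕ) :
    ∃ K δ : ℝ, 0 < K ∧ 0 < δ ∧
      (∀ (n N₀ : ℕ) [NeZero n] [NeZero N₀] (x : Tor (fine n (fun _ : Fin (d + 1) => N₀))) (μ : Fin (d + 1)) (y : Fin (d + 1) → ℤ)
          (lam : Fin (d + 1)),
        ‖cLeg N₀ n x μ (toT (fun _ : Fin (d + 1) => N₀) y, lam)‖
          ≤ K * Real.exp (-(δ * torusSupNorm (fun _ : Fin (d + 1) => N₀) (rep (fun _ : Fin (d + 1) => N₀) (blockOf n (fun _ : Fin (d + 1) => N₀) x) - y)))) ∧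
      (∀ (N R N₀ : ℕ) [NeZero N] [NeZero R] [NeZero N₀] (x' : Tor (fine (R * N) (fun _ : Fin (d + 1) => N₀))) (μ : Fin (d + 1))
          (y : Fin (d + 1) → ℤ) (lam : Fin (d + 1)),
        ‖cLeg N₀ (R * N) x' μ (toT (fun _ : Fin (d + 1) => N₀) y, lam) - cLeg N₀ N (par N R (fun _ : Fin (d + 1) => N₀) x') μ (toT (fun _ : Fin (d + 1) => N₀) y, lam)‖
          ≤ K * ((((R : ℝ) - 1) / ((R : ℝ) * N)) * (2 + Real.log ((R * N : ℕ) : ℝ) + Real.log (N : ℝ)) + 1 / N)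
              * Real.exp (-(δ * torusSupNorm (fun _ : Fin (d + 1) => N₀) (rep (fun _ : Fin (d + 1) => N₀) (blockOf (R * N) (fun _ : Fin (d + 1) => N₀) x') - y)))) := by
  obtain ⟨K, δ, hK, hδ, hcol, hstep⟩ := colOp_two_clauses_cubic d
  refine ⟨K, δ, hK, hδ, ?_, ?_⟩
  · intro n N₀ _ _ x μ y lam
    have h := hcol n N₀ (x, μ) (toT (fun _ : Fin (d + 1) => N₀) y, lam)
    rw [torusSupNorm_sub_rep_toT] at h
    exact h
  · intro N R N₀ _ _ _ x' μ y lam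
    have h := hstep N R N₀ (x', μ) (toT (fun _ : Fin (d + 1) => N₀) y, lam)
    rw [Matrix.sub_apply, stairV_mul_apply, torusSupNorm_sub_rep_toT] at h
    exact h

end ColumnLeg

/-! ## §2 The background-vertex chain at `a = 1` IS a three-leg chain -/

section Identification

variable (N₀ : ℕ) [NeZero N₀] (n : ℕ) [NeZero n]

/-- `M̃_n = 𝒢_1Q*` at `a = 1` (`MsoftV = a•colOp`). [folklore] -/
theorem MsoftV_one_apply (M : Fin (d + 1) → ℕ) [∀ μ, NeZero (M μ)] (X : Tor (fine n M) × Fin (d + 1)) (q : Src M) :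
    MsoftV n M 1 X q = colOp n M 1 X q := by
  rw [MsoftV_eq_smul_colOp, Complex.ofReal_one, one_smul]

/-- **`K_b = chain3 (∂H, 𝒢Q*(·,b), ∂H)`**: at `a = 1` the background-vertex chain sourced at `b` is the three-leg chain with the column leg in
the middle slot (source `b`) and the constant cubic vertex `(i, μ, j) ↦ c i j μ`. [folklore] -/
theorem vtxChain_bgVtx_eq_chain3 (c : VIdx d → VIdx d → Fin (d + 1) → ℂ) (b s s' : Src (fun _ : Fin (d + 1) => N₀)) :
    vtxChain n (fun _ : Fin (d + 1) => N₀) (bgVtx n (fun _ : Fin (d + 1) => N₀) 1 c b) s s'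
      = chain3 n (fun _ : Fin (d + 1) => N₀) (dLeg (fun _ : Fin (d + 1) => N₀) n) (cLeg N₀ n) (dLeg (fun _ : Fin (d + 1) => N₀) n)
          (fun _ i μ j => c i j μ) s b s' := by
  unfold vtxChain chain3
  refine Finset.sum_congr rfl fun x _ => ?_
  congr 1
  refine Finset.sum_congr rfl fun i _ => ?_
  simp only [bgVtx, dLeg, cLeg, Finset.sum_mul, MsoftV_one_apply]
  rw [Finset.sum_comm]
  exact Finset.sum_congr rfl fun μ _ => Finset.sum_congr rfl fun j _ => by ring

end Identification

/-! ## §3 Both clauses with three-centre decay -/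

section Chain

variable (L : ℕ) [NeZero L] (N₀ : ℕ) [NeZero N₀]

/-- **TWO GRADIENT LEGS OF `H_k` + THE SOFT COLUMN SOURCED AT A UNIT BOND `b`, LOCALISED: BOTH (CONV-C) CLAUSES AT `U = 1` WITH THREE-CENTRE
DECAY** (`a = 1`, every CUBIC torus `N₀`, `L ≥ 2`; θ = θG(L,½) = L^{−1∕4}): there are `κ > 0`, `C ≥ 0`, `0 ≤ θ < 1` — functions of `d, L, c`
only, NOT of `N₀` — with, for every level `k`, unit bond `b = (toT b̄, λ_b)`, sources `(toT y, λ), (toT y′, λ′)`: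
 (i) `‖K_b^{(n_k)}(y,λ;y′,λ′)‖ ≤ C·e^{−κ(|y−b̄|_T + |b̄−y′|_T)}`;
 (ii) `‖K_b^{(n_{k+1})}(y,λ;y′,λ′) − K_b^{(n_k)}(y,λ;y′,λ′)‖ ≤ C·θ^k·e^{−κ(|y−b̄|_T + |b̄−y′|_T)}`,
where `K_b^{(n)} = vtxChain n T (bgVtx n T 1 c b)` (`T = fun _ => N₀`).  Hence `Σ_b |u(b)|·‖K_b‖` is bounded by `C·latticeConst·sup|u|`
uniformly in the volume. [cite: King1986, §4 p.672 (Leibniz); Balaban1984PropagatorsI, (1.63) p.28, (1.103) p.35] [folklore] -/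
theorem bg_chain_two_clauses_loc (hL : 2 ≤ L) (c : VIdx d → VIdx d → Fin (d + 1) → ℂ) :
    ∃ κ C θ : ℝ, 0 < κ ∧ 0 ≤ C ∧ 0 ≤ θ ∧ θ < 1 ∧
      (∀ (k N₀ : ℕ) [NeZero N₀] (bb y y' : Fin (d + 1) → ℤ) (lamb lam lam' : Fin (d + 1)),
        ‖vtxChain (lev L k) (fun _ : Fin (d + 1) => N₀) (bgVtx (lev L k) (fun _ : Fin (d + 1) => N₀) 1 c (toT (fun _ : Fin (d + 1) => N₀) bb, lamb))
            (toT (fun _ : Fin (d + 1) => N₀) y, lam) (toT (fun _ : Fin (d + 1) => N₀) y', lam')‖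
          ≤ C * Real.exp (-(κ * (torusSupNorm (fun _ : Fin (d + 1) => N₀) (y - bb) + torusSupNorm (fun _ : Fin (d + 1) => N₀) (bb - y'))))) ∧
      (∀ (k N₀ : ℕ) [NeZero N₀] (bb y y' : Fin (d + 1) → ℤ) (lamb lam lam' : Fin (d + 1)),
        ‖vtxChain (L * lev L k) (fun _ : Fin (d + 1) => N₀) (bgVtx (L * lev L k) (fun _ : Fin (d + 1) => N₀) 1 c (toT (fun _ : Fin (d + 1) => N₀) bb, lamb))
              (toT (fun _ : Fin (d + 1) => N₀) y, lam) (toT (fun _ : Fin (d + 1) => N₀) y', lam')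
            - vtxChain (lev L k) (fun _ : Fin (d + 1) => N₀) (bgVtx (lev L k) (fun _ : Fin (d + 1) => N₀) 1 c (toT (fun _ : Fin (d + 1) => N₀) bb, lamb))
              (toT (fun _ : Fin (d + 1) => N₀) y, lam) (toT (fun _ : Fin (d + 1) => N₀) y', lam')‖
          ≤ C * thetaG L (1/2) ^ k
              * Real.exp (-(κ * (torusSupNorm (fun _ : Fin (d + 1) => N₀) (y - bb) + torusSupNorm (fun _ : Fin (d + 1) => N₀) (bb - y'))))) := by
  have hL1 : 1 ≤ L := le_trans (by norm_num) hL
  have hL0 : (0 : ℝ) < L := by exact_mod_cast hL1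
  obtain ⟨K, δc, hK, hδc, hcol, hstep⟩ := cLeg_letters d
  -- common rate
  set δ : ℝ := min (dec d) δc with hδ
  have hδ0 : 0 < δ := lt_min (dec_pos d) hδc
  have hδ1 : δ ≤ dec d := min_le_left _ _
  have hδ2 : δ ≤ δc := min_le_right _ _
  -- vertex bound
  set B : ℝ := cnorm c with hB
  have hB0 : 0 ≤ B := cnorm_nonneg c
  have hcB : ∀ (i : VIdx d) (μ : Fin (d + 1)) (j : VIdx d), ‖c i j μ‖ ≤ B := fun i μ j =>
    (Finset.single_le_sum (f := fun μ => ‖c i j μ‖) (fun _ _ => norm_nonneg _) (Finset.mem_univ μ)).trans (sum_norm_le_cnorm c i j)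
  have hC : 0 ≤ CdecD d := CdecD_nonneg
  have hCG := CG_nonneg d (1/2) L
  have hϑ0 : 0 ≤ thetaG L (1/2) := (thetaG_pos hL1 _).le
  have hϑ1 : thetaG L (1/2) < 1 := thetaG_lt_one hL (by norm_num)
  -- the column's one-step constant along the tower
  set AK : ℝ := K * ((3 + 2 * Real.log L) * (1 - thetaG L (1/2))⁻¹) with hAK
  have hAK0 : 0 ≤ AK := by
    have hℓ : 0 ≤ Real.log L := Real.log_nonneg (by exact_mod_cast hL1)
    have : 0 < 1 - thetaG L (1/2) := by linarith
    positivity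
  have hlc : 0 ≤ latticeConst (d + 1) (δ / 3) := latticeConst_nonneg _ (by positivity)
  have hcardV : (Fintype.card (VIdx d) : ℝ) = ((d : ℝ) + 1) * ((d : ℝ) + 1) := by simp [VIdx]
  have hcardF : (Fintype.card (Fin (d + 1)) : ℝ) = (d : ℝ) + 1 := by simp
  set C1 : ℝ := (((d : ℝ) + 1) * ((d : ℝ) + 1)) * ((d : ℝ) + 1) * (((d : ℝ) + 1) * ((d : ℝ) + 1)) * B * CdecD d * K * CdecD d
    * latticeConst (d + 1) (δ / 3) with hC1
  set C2 : ℝ := (((d : ℝ) + 1) * ((d : ℝ) + 1)) * ((d : ℝ) + 1) * (((d : ℝ) + 1) * ((d : ℝ) + 1))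
    * (CG d (1/2) L * B * K * CdecD d + CdecD d * 0 * K * CdecD d + CdecD d * B * AK * CdecD d + CdecD d * B * K * CG d (1/2) L)
    * latticeConst (d + 1) (δ / 3) with hC2
  have hC1' : 0 ≤ C1 := by positivity
  have hC2' : 0 ≤ C2 := by positivity
  -- weakening a block letter to the common rate
  have hweak : ∀ {N₀ : ℕ} [NeZero N₀] {A r : ℝ} (z : Fin (d + 1) → ℤ), 0 ≤ A → δ ≤ r →
      A * Real.exp (-(r * torusSupNorm (fun _ : Fin (d + 1) => N₀) z)) ≤ A * Real.exp (-(δ * torusSupNorm (fun _ : Fin (d + 1) => N₀) z)) := by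
    intro N₀ _ A r z hA hr
    refine mul_le_mul_of_nonneg_left (Real.exp_le_exp.mpr ?_) hA
    have hz := B4TorusKernel.MultiPeriod.torusSupNorm_nonneg (B6Cov2156Torus.one_le_M (fun _ : Fin (d + 1) => N₀)) z
    nlinarith
  refine ⟨δ / 3, max C1 C2, thetaG L (1/2), by positivity, le_max_of_le_left hC1', hϑ0, hϑ1, ?_, ?_⟩
  · intro k N₀ _ bb y y' lamb lam lam'
    rw [vtxChain_bgVtx_eq_chain3]
    have h := norm_chain3_le (lev L k) (fun _ : Fin (d + 1) => N₀) (dLeg (fun _ : Fin (d + 1) => N₀) (lev L k)) (cLeg N₀ (lev L k))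
      (dLeg (fun _ : Fin (d + 1) => N₀) (lev L k)) (fun _ i μ j => c i j μ) (δ := δ) hδ0 hB0 hC hK.le hC (fun _ i μ j => hcB i μ j)
      (fun x i w l => (norm_dker_le_block (lev L k) (fun _ : Fin (d + 1) => N₀) i.1 l i.2 x w).trans (hweak _ hC hδ1))
      (fun x μ w l => (hcol (lev L k) N₀ x μ w l).trans (hweak _ hK.le hδ2))
      (fun x j w l => (norm_dker_le_block (lev L k) (fun _ : Fin (d + 1) => N₀) j.1 l j.2 x w).trans (hweak _ hC hδ1))
      y bb y' lam lamb lam'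
    rw [hcardV, hcardF] at h
    exact h.trans (mul_le_mul_of_nonneg_right (le_max_left _ _) (Real.exp_pos _).le)
  · intro k N₀ _ bb y y' lamb lam lam'
    rw [vtxChain_bgVtx_eq_chain3, vtxChain_bgVtx_eq_chain3]
    have hθk : 0 ≤ thetaG L (1/2) ^ k := pow_nonneg hϑ0 k
    -- the column's parent law along the tower: amplitude `K·colAmp ≤ AK·θG^k`
    have hcolstep : ∀ (x' : Tor (fine (L * lev L k) (fun _ : Fin (d + 1) => N₀))) (μ : Fin (d + 1)) (w : Fin (d + 1) → ℤ) (l : Fin (d + 1)),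
        ‖cLeg N₀ (L * lev L k) x' μ (toT (fun _ : Fin (d + 1) => N₀) w, l)
            - cLeg N₀ (lev L k) (par (lev L k) L (fun _ : Fin (d + 1) => N₀) x') μ (toT (fun _ : Fin (d + 1) => N₀) w, l)‖
          ≤ AK * thetaG L (1/2) ^ k
              * Real.exp (-(δ * torusSupNorm (fun _ : Fin (d + 1) => N₀) (rep (fun _ : Fin (d + 1) => N₀) (blockOf (L * lev L k) (fun _ : Fin (d + 1) => N₀) x') - w))) := by
      intro x' μ w l
      refine ((hstep (lev L k) L N₀ x' μ w l).trans (hweak _ (mul_nonneg hK.le ?_) hδ2)).trans (mul_le_mul_of_nonneg_right ?_ (Real.exp_pos _).le)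
      · -- the amplitude is nonnegative
        have hN : (1 : ℝ) ≤ (lev L k : ℕ) := by exact_mod_cast Nat.one_le_iff_ne_zero.mpr (NeZero.ne (lev L k))
        have hRN : (1 : ℝ) ≤ ((L * lev L k : ℕ) : ℝ) := by exact_mod_cast Nat.one_le_iff_ne_zero.mpr (NeZero.ne (L * lev L k))
        have h1 : 0 ≤ Real.log ((L * lev L k : ℕ) : ℝ) := Real.log_nonneg hRN
        have h2 : 0 ≤ Real.log ((lev L k : ℕ) : ℝ) := Real.log_nonneg hN
        have h3 : 0 ≤ ((L : ℝ) - 1) / ((L : ℝ) * (lev L k : ℕ)) :=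
          div_nonneg (by linarith [show (1 : ℝ) ≤ L by exact_mod_cast hL1]) (by positivity)
        positivity
      · rw [hAK, mul_assoc]
        exact mul_le_mul_of_nonneg_left (colAmp_le hL k) hK.le
    have h := norm_chain3_succ_sub_le (fun _ : Fin (d + 1) => N₀)
      (dLeg (fun _ : Fin (d + 1) => N₀) (L * lev L k)) (dLeg (fun _ : Fin (d + 1) => N₀) (lev L k))
      (cLeg N₀ (L * lev L k)) (cLeg N₀ (lev L k))
      (dLeg (fun _ : Fin (d + 1) => N₀) (L * lev L k)) (dLeg (fun _ : Fin (d + 1) => N₀) (lev L k))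
      (fun _ i μ j => c i j μ) (fun _ i μ j => c i j μ) (δ := δ)
      (ρP := CG d (1/2) L * thetaG L (1/2) ^ k) (ρQ := AK * thetaG L (1/2) ^ k) (ρW := CG d (1/2) L * thetaG L (1/2) ^ k) (εm := 0)
      hδ0 hB0 hC hK.le hC (by positivity) (by positivity) (by positivity) le_rfl
      (fun _ i μ j => hcB i μ j) (fun _ i μ j => hcB i μ j) (fun x' i μ j => by rw [sub_self, norm_zero])
      (fun x' i w l => (norm_dLeg_par_le L (fun _ : Fin (d + 1) => N₀) k x' i w l).trans (hweak _ hC hδ1))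
      (fun x' μ w l => (hcol (L * lev L k) N₀ x' μ w l).trans (hweak _ hK.le hδ2))
      (fun x' μ w l => by
        have h := (hcol (lev L k) N₀ (par (lev L k) L (fun _ : Fin (d + 1) => N₀) x') μ w l).trans (hweak _ hK.le hδ2)
        rw [blockOf_par_eq] at h
        exact h)
      (fun x' j w l => (norm_dker_le_block (L * lev L k) (fun _ : Fin (d + 1) => N₀) j.1 l j.2 x' w).trans (hweak _ hC hδ1))
      (fun x' i w l => (norm_dker_par_sub_le_lev L (fun _ : Fin (d + 1) => N₀) hL k (x', i.1) i.2 l w (α := 1/2) (by norm_num) (by norm_num)).trans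
        (hweak _ (by positivity) hδ1))
      hcolstep
      (fun x' j w l => (norm_dker_par_sub_le_lev L (fun _ : Fin (d + 1) => N₀) hL k (x', j.1) j.2 l w (α := 1/2) (by norm_num) (by norm_num)).trans
        (hweak _ (by positivity) hδ1))
      y bb y' lam lamb lam'
    rw [hcardV, hcardF] at h
    refine h.trans ?_
    have e : (((d : ℝ) + 1) * ((d : ℝ) + 1)) * ((d : ℝ) + 1) * (((d : ℝ) + 1) * ((d : ℝ) + 1))
        * (CG d (1/2) L * thetaG L (1/2) ^ k * B * K * CdecD d + CdecD d * 0 * K * CdecD d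
            + CdecD d * B * (AK * thetaG L (1/2) ^ k) * CdecD d + CdecD d * B * K * (CG d (1/2) L * thetaG L (1/2) ^ k))
        * latticeConst (d + 1) (δ / 3) = C2 * thetaG L (1/2) ^ k := by rw [hC2]; ring
    rw [e]
    exact mul_le_mul_of_nonneg_right (mul_le_mul_of_nonneg_right (le_max_right _ _) hθk) (Real.exp_pos _).le

end Chain

end Summit.QuantumFields.BalabanUV.Beta.GAN24.BackgroundVertexChainLoc

end
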